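import Mathlib
import Literature.Analysis.Asymptotics.WidderAbelianLaplaceProofs
import Literature.Analysis.Asymptotics.KaramataTauberianLaplaceTwo
import HarnessLib

/-!
# Einstein–Helfand slope ⇒ Abel limit of the heat-variance Laplace transform
(helper for crux `CoercivePulse.AbelRegularity`, item stmt-AtomisticToContinuum-15384; pure real analysis)

For the heat variance `V ≥ 0` of a stationary current with the Laplace identity
`A(ν) = ∫₀^∞ e^{-νt} C(t) dt = (ν²/2) ∫₀^∞ e^{-νt} V(t) dt` (Helfand; in tree as
`CageBudgetFekete.HeatVarianceCalculus`), existence of the Einstein–Helfand slope `V(t)/t → ℓ` decides the Abel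
means: `A(ν) → ℓ/2` if `ℓ < ∞` (Widder's Abelian theorem at index `2`, signed, in tree as
`Literature.Analysis.Asymptotics.Widder1941_abelian_laplace_holds`, after the Cesàro step
`(∫₀ᵗ V)/t² → ℓ/2`), and `A(ν) → +∞` if `V(t)/t → +∞` and `V ≥ 0` (comparison with `2R(t - t₀)`).

* `tendsto_setIntegral_Ioc_div_sq` — `V(t)/t → ℓ` ⇒ `(∫_{(0,t]} V)/t² → ℓ/2` (`V` locally integrable).
* `integrableOn_Ioc_of_laplace` — Laplace integrability at `s = 1` ⇒ local integrability on `(0,T]`.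
* `abel_tendsto_of_slope` — finite slope ⇒ `A → ℓ/2` along `𝓝[>] 0`.
* `abel_tendsto_atTop_of_slope` — infinite slope, `V ≥ 0` ⇒ `A → +∞` along `𝓝[>] 0`.
-/

noncomputable section

namespace Summit.AtomisticToContinuum.FouriersLaw.Theorems.AbelRegularity.Sketch

open MeasureTheory Filter Set
open scoped Topology

/-- **Cesàro step.** If `V` is integrable on every `(0, T]` and `V(t)/t → ℓ` as `t → ∞`, then
`(∫_{(0,t]} V)/t² → ℓ/2`. [folklore] -/
theorem tendsto_setIntegral_Ioc_div_sq {V : ℝ → ℝ} {ℓ : ℝ}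
    (hloc : ∀ T : ℝ, IntegrableOn V (Ioc 0 T))
    (h : Tendsto (fun t : ℝ => V t / t) atTop (𝓝 ℓ)) :
    Tendsto (fun t : ℝ => (∫ u in Ioc 0 t, V u) / t ^ 2) atTop (𝓝 (ℓ / 2)) := by
  have hlin : ∀ (c : ℝ) (T : ℝ), IntegrableOn (fun u : ℝ => c * u) (Ioc 0 T) := fun c T =>
    (by fun_prop : Continuous fun u : ℝ => c * u).integrableOn_Icc.mono_set Ioc_subset_Icc_self
  have hg : ∀ T : ℝ, IntegrableOn (fun u : ℝ => V u - ℓ * u) (Ioc 0 T) := fun T => (hloc T).sub (hlin ℓ T)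
  rw [Metric.tendsto_atTop]
  intro ε hε
  -- eventually `|V u - ℓ u| ≤ (ε/2) u`
  have h1 : ∀ᶠ u in atTop, |V u - ℓ * u| ≤ ε / 2 * u ∧ 0 < u := by
    have h' := (Metric.tendsto_nhds.1 h) (ε / 2) (half_pos hε)
    filter_upwards [h', eventually_gt_atTop 0] with u hu hu0
    refine ⟨?_, hu0⟩
    rw [Real.dist_eq] at hu
    have e : V u - ℓ * u = (V u / u - ℓ) * u := by field_simp
    rw [e, abs_mul, abs_of_pos hu0]
    exact mul_le_mul_of_nonneg_right hu.le hu0.le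
  obtain ⟨T, hT⟩ := eventually_atTop.1 h1
  have hT0 : 0 < T := (hT T le_rfl).2
  set M : ℝ := |∫ u in Ioc 0 T, (V u - ℓ * u)| with hM
  have hM0 : 0 ≤ M := abs_nonneg _
  refine ⟨max T (Real.sqrt (2 * M / ε) + 1), fun t ht => ?_⟩
  have htT : T ≤ t := le_trans (le_max_left _ _) ht
  have ht1 : Real.sqrt (2 * M / ε) + 1 ≤ t := le_trans (le_max_right _ _) ht
  have ht0 : 0 < t := hT0.trans_le htT
  have ht2 : 0 < t ^ 2 := by positivity
  -- `∫₀ᵗ V = ∫₀ᵗ (V - ℓ u) + ℓ t²/2`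
  have hsplit : ∫ u in Ioc 0 t, V u = (∫ u in Ioc 0 t, (V u - ℓ * u)) + ℓ * t ^ 2 / 2 := by
    rw [integral_sub (hloc t) (hlin ℓ t)]
    have e : ∫ u in Ioc 0 t, ℓ * u = ℓ * t ^ 2 / 2 := by
      rw [← intervalIntegral.integral_of_le ht0.le, intervalIntegral.integral_const_mul, integral_id]
      ring
    rw [e]
    ring
  -- split the defect integral at `T`
  have hsplit2 : ∫ u in Ioc 0 t, (V u - ℓ * u) =
      (∫ u in Ioc 0 T, (V u - ℓ * u)) + ∫ u in Ioc T t, (V u - ℓ * u) := by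
    rw [← intervalIntegral.integral_of_le ht0.le, ← intervalIntegral.integral_of_le hT0.le,
      ← intervalIntegral.integral_of_le htT, intervalIntegral.integral_add_adjacent_intervals]
    · exact (intervalIntegrable_iff_integrableOn_Ioc_of_le hT0.le).2 (hg T)
    · exact (intervalIntegrable_iff_integrableOn_Ioc_of_le htT).2
        ((hg t).mono_set (Ioc_subset_Ioc_left hT0.le))
  -- the tail is at most `(ε/2) · t²/2`
  have htail : |∫ u in Ioc T t, (V u - ℓ * u)| ≤ ε / 2 * (t ^ 2 / 2) := by
    have hgt : IntegrableOn (fun u : ℝ => V u - ℓ * u) (Ioc T t) :=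
      (hg t).mono_set (Ioc_subset_Ioc_left hT0.le)
    calc |∫ u in Ioc T t, (V u - ℓ * u)| ≤ ∫ u in Ioc T t, |V u - ℓ * u| :=
          abs_integral_le_integral_abs
      _ ≤ ∫ u in Ioc T t, ε / 2 * u := by
          refine setIntegral_mono_on hgt.abs ((hlin (ε / 2) t).mono_set (Ioc_subset_Ioc_left hT0.le))
            measurableSet_Ioc fun u hu => (hT u hu.1.le).1
      _ = ε / 2 * ((t ^ 2 - T ^ 2) / 2) := by
          rw [← intervalIntegral.integral_of_le htT, intervalIntegral.integral_const_mul, integral_id]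
      _ ≤ ε / 2 * (t ^ 2 / 2) := by
          have : (t ^ 2 - T ^ 2) / 2 ≤ t ^ 2 / 2 := by nlinarith [sq_nonneg T]
          exact mul_le_mul_of_nonneg_left this (by positivity)
  -- `M/t² < ε/2`
  have hMt : M / t ^ 2 < ε / 2 := by
    have hs : Real.sqrt (2 * M / ε) < t := by linarith
    have hs0 : 0 ≤ Real.sqrt (2 * M / ε) := Real.sqrt_nonneg _
    have h2 : 2 * M / ε < t ^ 2 := by
      have := Real.sq_sqrt (show 0 ≤ 2 * M / ε by positivity)
      nlinarith
    rw [div_lt_iff₀ ht2]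
    rw [div_lt_iff₀ hε] at h2
    linarith
  rw [Real.dist_eq, hsplit, hsplit2]
  have e : ((∫ u in Ioc 0 T, (V u - ℓ * u)) + (∫ u in Ioc T t, (V u - ℓ * u)) + ℓ * t ^ 2 / 2) / t ^ 2 -
      ℓ / 2 = ((∫ u in Ioc 0 T, (V u - ℓ * u)) + ∫ u in Ioc T t, (V u - ℓ * u)) / t ^ 2 := by
    field_simp
    ring
  rw [e, abs_div, abs_of_pos ht2, div_lt_iff₀ ht2]
  calc |(∫ u in Ioc 0 T, (V u - ℓ * u)) + ∫ u in Ioc T t, (V u - ℓ * u)|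
      ≤ M + ε / 2 * (t ^ 2 / 2) := (abs_add_le _ _).trans (add_le_add le_rfl htail)
    _ < ε * t ^ 2 := by
        have : M < ε / 2 * t ^ 2 := by rwa [div_lt_iff₀ ht2] at hMt
        nlinarith

/-- Laplace integrability at `s = 1` gives local integrability: `V = e^{t} · (e^{-t} V)` on `(0, T] ⊆ [0, T]`.
[folklore] -/
theorem integrableOn_Ioc_of_laplace {V : ℝ → ℝ}
    (hint : ∀ s : ℝ, 0 < s → IntegrableOn (fun t : ℝ => Real.exp (-(s * t)) * V t) (Ioi 0)) (T : ℝ) :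
    IntegrableOn V (Ioc 0 T) := by
  have h1 : IntegrableOn (fun t : ℝ => Real.exp (-(1 * t)) * V t) (Ioc 0 T) :=
    (hint 1 one_pos).mono_set Ioc_subset_Ioi_self
  have h2 : IntegrableOn (fun t : ℝ => Real.exp (1 * t) * (Real.exp (-(1 * t)) * V t)) (Ioc 0 T) :=
    h1.continuousOn_mul_of_subset (by fun_prop : Continuous fun t : ℝ => Real.exp (1 * t)).continuousOn
      isCompact_Icc measurableSet_Ioc Ioc_subset_Icc_self
  refine h2.congr_fun (fun t _ => ?_) measurableSet_Ioc
  show Real.exp (1 * t) * (Real.exp (-(1 * t)) * V t) = V t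
  rw [← mul_assoc, ← Real.exp_add, add_neg_cancel, Real.exp_zero, one_mul]

/-- **Finite Einstein–Helfand slope ⇒ Abel limit.** If `e^{-st}V` is integrable on `(0,∞)` for every `s > 0`,
`A(ν) = (ν²/2)∫₀^∞ e^{-νt}V(t)dt` for `ν > 0`, and `V(t)/t → ℓ`, then `A(ν) → ℓ/2` as `ν ↓ 0`
(Widder's Abelian theorem at index `2`, signed case, after the Cesàro step).
[cite: Widder1941, Ch. V §1 Theorem 1 and Corollary 1a] -/
theorem abel_tendsto_of_slope {V A : ℝ → ℝ} {ℓ : ℝ}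
    (hint : ∀ s : ℝ, 0 < s → IntegrableOn (fun t : ℝ => Real.exp (-(s * t)) * V t) (Ioi 0))
    (hA : ∀ ν : ℝ, 0 < ν → A ν = ν ^ 2 / 2 * ∫ t in Ioi (0:ℝ), Real.exp (-(ν * t)) * V t)
    (h : Tendsto (fun t : ℝ => V t / t) atTop (𝓝 ℓ)) :
    Tendsto A (𝓝[>] 0) (𝓝 (ℓ / 2)) := by
  have hloc : ∀ T : ℝ, IntegrableOn V (Ioc 0 T) := integrableOn_Ioc_of_laplace hint
  have hG : Real.Gamma (2 + 1) = 2 := by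
    rw [show (2:ℝ) + 1 = (2:ℕ) + 1 by norm_num, Real.Gamma_nat_eq_factorial]
    norm_num
  have hces : Tendsto (fun t : ℝ => Real.Gamma (2 + 1) * (∫ u in Ioc 0 t, V u) * t ^ (-(2:ℝ))) atTop (𝓝 ℓ) := by
    have hc := (tendsto_setIntegral_Ioc_div_sq hloc h).const_mul 2
    rw [show 2 * (ℓ / 2) = ℓ by ring] at hc
    refine hc.congr' ?_
    filter_upwards [eventually_gt_atTop 0] with t ht
    rw [hG, Real.rpow_neg ht.le, Real.rpow_two]
    field_simp
  have hW := Literature.Analysis.Asymptotics.Widder1941_abelian_laplace_holds V 2 ℓ (by norm_num) hloc hint hces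
  have hW' := hW.const_mul (1 / 2 : ℝ)
  rw [show (1 / 2 : ℝ) * ℓ = ℓ / 2 by ring] at hW'
  refine hW'.congr' ?_
  filter_upwards [self_mem_nhdsWithin] with s hs
  rw [hA s hs, Real.rpow_two]
  ring

/-- **Infinite Einstein–Helfand slope ⇒ divergent Abel means.** If `V ≥ 0` on `(0,∞)`, `e^{-st}V` is integrable on
`(0,∞)` for every `s > 0`, `A(ν) = (ν²/2)∫₀^∞ e^{-νt}V(t)dt` for `ν > 0`, and `V(t)/t → +∞`, then `A(ν) → +∞` as
`ν ↓ 0`: beyond `t₀`, `V(t) ≥ 4R·t`, so `V ≥ 4R(t - t₀)` on `(0,∞)` and `A(ν) ≥ 2R(1 - νt₀) ≥ R` for `ν ≤ 1/(2t₀)`.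
[folklore] -/
theorem abel_tendsto_atTop_of_slope {V A : ℝ → ℝ}
    (hV0 : ∀ t : ℝ, 0 < t → 0 ≤ V t)
    (hint : ∀ s : ℝ, 0 < s → IntegrableOn (fun t : ℝ => Real.exp (-(s * t)) * V t) (Ioi 0))
    (hA : ∀ ν : ℝ, 0 < ν → A ν = ν ^ 2 / 2 * ∫ t in Ioi (0:ℝ), Real.exp (-(ν * t)) * V t)
    (h : Tendsto (fun t : ℝ => V t / t) atTop atTop) :
    Tendsto A (𝓝[>] 0) atTop := by
  -- it suffices to exceed every `R > 0`
  rw [tendsto_atTop]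
  suffices H : ∀ R : ℝ, 0 < R → ∀ᶠ ν in 𝓝[>] (0:ℝ), R ≤ A ν by
    intro R
    filter_upwards [H (max R 1) (by positivity)] with ν hν
    exact (le_max_left _ _).trans hν
  intro R hR
  -- beyond `t₀ > 0`: `4R t ≤ V t`
  obtain ⟨t₀, ht₀⟩ := eventually_atTop.1 ((tendsto_atTop.1 h (4 * R)).and (eventually_gt_atTop 0))
  have ht₀0 : 0 < t₀ := (ht₀ t₀ le_rfl).2
  have hlow : ∀ t : ℝ, 0 < t → 4 * R * (t - t₀) ≤ V t := by
    intro t ht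
    rcases le_or_gt t₀ t with hle | hlt
    · have h1 := (ht₀ t hle).1
      rw [le_div_iff₀ ht] at h1
      nlinarith
    · exact le_trans (by nlinarith) (hV0 t ht)
  -- the comparison integrals
  have I0 : ∀ ν : ℝ, 0 < ν → ∫ t in Ioi (0:ℝ), Real.exp (-(ν * t)) = 1 / ν := fun ν hν => by
    have h' := integral_exp_mul_Ioi (neg_lt_zero.mpr hν) 0
    simp only [neg_mul, mul_zero, Real.exp_zero] at h'
    rw [h', neg_div_neg_eq]
  have I1 : ∀ ν : ℝ, 0 < ν → ∫ t in Ioi (0:ℝ), Real.exp (-(ν * t)) * t = 1 / ν ^ 2 := fun ν hν => by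
    have h' := Real.integral_rpow_mul_exp_neg_mul_Ioi (a := 2) (r := ν) two_pos hν
    have h2 : Real.Gamma 2 = 1 := by simp
    rw [h2, mul_one] at h'
    have h3 : ∫ t in Ioi (0 : ℝ), Real.exp (-(ν * t)) * t =
        ∫ t in Ioi (0 : ℝ), t ^ ((2 : ℝ) - 1) * Real.exp (-(ν * t)) := by
      refine setIntegral_congr_fun measurableSet_Ioi (fun t _ => ?_)
      norm_num
      ring
    rw [h3, h', Real.rpow_two, one_div, inv_pow, one_div]
  have hint0 : ∀ ν : ℝ, 0 < ν → IntegrableOn (fun t : ℝ => Real.exp (-(ν * t))) (Ioi 0) := fun ν hν => by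
    simpa only [neg_mul] using exp_neg_integrableOn_Ioi 0 hν
  have hint1 : ∀ ν : ℝ, 0 < ν → IntegrableOn (fun t : ℝ => Real.exp (-(ν * t)) * t) (Ioi 0) := fun ν hν => by
    have h' := Literature.Analysis.Asymptotics.KaramataLaplace.hint_id ν hν
    exact h'.congr_fun (fun t _ => by ring) measurableSet_Ioi
  -- lower bound `A ν ≥ 2R(1 - ν t₀)`
  have hAlow : ∀ ν : ℝ, 0 < ν → 2 * R * (1 - ν * t₀) ≤ A ν := by
    intro ν hν
    have hcmp : ∫ t in Ioi (0:ℝ), Real.exp (-(ν * t)) * (4 * R * (t - t₀)) ≤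
        ∫ t in Ioi (0:ℝ), Real.exp (-(ν * t)) * V t := by
      refine setIntegral_mono_on ?_ (hint ν hν) measurableSet_Ioi fun t ht => ?_
      · have e : (fun t : ℝ => Real.exp (-(ν * t)) * (4 * R * (t - t₀))) =
            fun t : ℝ => 4 * R * (Real.exp (-(ν * t)) * t) - 4 * R * t₀ * Real.exp (-(ν * t)) := by
          funext t; ring
        rw [e]
        exact ((hint1 ν hν).const_mul _).sub ((hint0 ν hν).const_mul _)
      · exact mul_le_mul_of_nonneg_left (hlow t ht) (Real.exp_pos _).le
    have hval : ∫ t in Ioi (0:ℝ), Real.exp (-(ν * t)) * (4 * R * (t - t₀)) = 4 * R * (1 / ν ^ 2) - 4 * R * t₀ * (1 / ν) := by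
      have e : (fun t : ℝ => Real.exp (-(ν * t)) * (4 * R * (t - t₀))) =
          fun t : ℝ => 4 * R * (Real.exp (-(ν * t)) * t) - 4 * R * t₀ * Real.exp (-(ν * t)) := by
        funext t; ring
      rw [e, integral_sub ((hint1 ν hν).const_mul _) ((hint0 ν hν).const_mul _), integral_const_mul,
        integral_const_mul, I1 ν hν, I0 ν hν]
    rw [hA ν hν]
    have hν2 : 0 < ν ^ 2 / 2 := by positivity
    calc 2 * R * (1 - ν * t₀) = ν ^ 2 / 2 * (4 * R * (1 / ν ^ 2) - 4 * R * t₀ * (1 / ν)) := by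
          field_simp
          ring
      _ ≤ ν ^ 2 / 2 * ∫ t in Ioi (0:ℝ), Real.exp (-(ν * t)) * V t := by
          rw [← hval]
          exact mul_le_mul_of_nonneg_left hcmp hν2.le
  -- for `ν ∈ (0, 1/(2t₀)]`: `A ν ≥ R`
  have hmem : Ioo (0:ℝ) (1 / (2 * t₀)) ∈ 𝓝[>] (0:ℝ) := Ioo_mem_nhdsGT (by positivity)
  filter_upwards [hmem] with ν hν
  have h1 : ν * t₀ ≤ 1 / 2 := by
    have := hν.2.le
    rw [le_div_iff₀ (by positivity)] at this
    linarith
  have h2 := hAlow ν hν.1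
  nlinarith

end Summit.AtomisticToContinuum.FouriersLaw.Theorems.AbelRegularity.Sketch

end
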